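import Mathlib.Analysis.CStarAlgebra.ContinuousLinearMap
import Mathlib.Analysis.CStarAlgebra.ContinuousFunctionalCalculus.Basic
import Mathlib.Analysis.CStarAlgebra.ContinuousFunctionalCalculus.Instances
import Literature.MathematicalPhysics.QuantumManyBody.ExcitationMap
import Literature.MathematicalPhysics.QuantumLattice.OverlapLocality
import Literature.MathematicalPhysics.QuantumLattice.LatticeGaugeDLR
import HarnessLib

/-!
# The Wilson–Dirac and overlap operators on the infinite lattice `ℤ⁴`

The infinite-volume setting of the lattice index / axial-anomaly literature — P. Hernández,
K. Jansen, M. Lüscher, Nucl. Phys. B 552 (1999) 363 (locality of Neuberger's operator on `ℤ⁴`);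
M. Lüscher, Nucl. Phys. B 538 (1999) 515 (anomaly of a Ginsparg–Wilson operator on `ℤ⁴`);
H. Igarashi, K. Okuyama, H. Suzuki, Nucl. Phys. B 644 (2002) 383, §2 (the operator `D^∞` on the
infinite lattice to which the finite-volume operator "is promoted" when `L → ∞`, introduced after
(2.5), and its anomaly density `𝒜^∞` (2.8)) — as DEFINITIONS over the tree's infinite-lattice
gauge fields `LGConfig 4 G` (`LatticeGaugeDLR.lean`), with exactly the conventions of the torus
operators `wilsonDirac` / `overlapKernel` / `overlapUnitary` (`GrassmannIntegral.lean`,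
`OverlapDirac.lean`: HJL App. A, `r = 1`, chiral `γ` basis). The tree already has the
infinite-lattice Wilson–Dirac KERNEL as an infinite matrix, `wilsonDiracZd`
(`BlockFermionRG.lean`, general `γ` family and `N_f` flavours); the bounded-OPERATOR version
below (needed for the functional calculus) has the same kernel (`wilsonDiracOpZd_apply` is that
formula with `γ = euclideanGamma`, one flavour):

* `ZdSpinorSpace N = ℓ²(ℤ⁴ × Fin N × Fin 4, ℂ)` — the one-particle Hilbert space (Mathlib `lp … 2`);
* `fwdHop`, `bwdHop` — the elementary covariant hops
  `f ↦ (x,a,α) ↦ (r∓γ_μ)_{αβ} ρ(U(x,μ))^{±}_{ab} f(x±μ̂,b,β)`, bounded operators built from the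
  tree's weighted relabellings `crossShift` (`ExcitationMap.lean`), each of norm `≤ |r| + 1`;
* `wilsonDiracOpZd ρ hρ U m r` — the Wilson–Dirac operator `D_W` on `ℤ⁴` as a bounded operator,
  with the pointwise formula `wilsonDiracOpZd_apply` (the kernel of the torus `wilsonDirac` with
  `TorusSite` replaced by `ℤ⁴`; equivalently the kernel `wilsonDiracZd ρ euclideanGamma U m r` of
  `BlockFermionRG.lean` at one flavour);
* `gammaFiveOpZd`, `overlapKernelOpZd ρ hρ U m₀ = Γ₅ D_W(U, −m₀, 1)` (the Hermitian kernel `H`),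
  `overlapSignOpZd = sign(H)` in Mathlib's continuous functional calculus of the C⋆-algebra of
  bounded operators, `overlapUnitaryOpZd = Γ₅ sign(H)`, `overlapDiracZeroOpZd = 1 + Γ₅ sign(H)`;
* `kernelEntryZd T p q = ⟪δ_p, T δ_q⟫` — position-space kernels, and the **axial anomaly
  density on `ℤ⁴`**, `anomalyDensityZd ρ hρ U m₀ x = Σ_{a,α} Re [Γ₅(1 − ½D₀)]((x,a,α),(x,a,α))
  = −½ Σ_{a,α} Re sign(H)((x,a,α),(x,a,α))` (IOS (2.8), the infinite-lattice version of (2.1);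
  Lüscher's `q(x) = −½ tr{γ₅ D(x,x)}` (1.2), equal since `tr γ₅ = 0`).

Definitions with bodies plus elementary `apply`/norm lemmas; no named facts. The analytic
properties (self-adjointness of `H` for unitary `ρ`, Neuberger's gap, HJL locality on `ℤ⁴`,
periodisation) are NOT proved here.

## References

* P. Hernández, K. Jansen, M. Lüscher, Nucl. Phys. B 552 (1999) 363–378, arXiv:hep-lat/9808010,
  §2 and App. A. [HernandezJansenLuscher1999]
* H. Igarashi, K. Okuyama, H. Suzuki, Nucl. Phys. B 644 (2002) 383, arXiv:hep-lat/0206003,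
  §2 eqs. (2.1), (2.8) and the text after (2.5). [IgarashiOkuyamaSuzuki2002]
* M. Lüscher, Nucl. Phys. B 538 (1999) 515, arXiv:hep-lat/9808021, eq. (1.2). [Luscher1999AbelianTopology]
* H. Neuberger, Phys. Lett. B 417 (1998) 141, eqs. (8)–(11). [Neuberger1998]
-/

noncomputable section

open Finset
open scoped InnerProductSpace ComplexConjugate
open Literature.Probability.LatticeModels (Site)
open Literature.MathematicalPhysics.QuantumManyBody.BoseGas.Fock (crossShift crossShift_apply
  norm_crossShift_le)

namespace Literature.MathematicalPhysics.QuantumLattice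

/-- The index set `ℤ⁴ × colour × spin` of lattice spinor fields on the infinite lattice.
[cite: HernandezJansenLuscher1999, §2] -/
abbrev ZdSpinorIdx (N : ℕ) : Type := Site 4 × Fin N × Fin 4

/-- **The one-particle space on `ℤ⁴`**: `ℓ²(ℤ⁴ × Fin N × Fin 4, ℂ)`. [cite: HernandezJansenLuscher1999, §2] -/
abbrev ZdSpinorSpace (N : ℕ) : Type := lp (fun _ : ZdSpinorIdx N => ℂ) 2

section Gamma

/-- The Euclidean `γ` matrices are unitary (Hermitian with `γ_μ² = 1`). [folklore] -/
theorem euclideanGamma_mem_unitaryGroup (μ : Fin 4) :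
    euclideanGamma μ ∈ Matrix.unitaryGroup (Fin 4) ℂ := by
  rw [Matrix.mem_unitaryGroup_iff, Matrix.star_eq_conjTranspose, (euclideanGamma_isHermitian μ).eq,
    euclideanGamma_mul_self]

/-- Entry bound `|(r·1 ∓ γ_μ)_{αβ}| ≤ |r| + 1`. [folklore] -/
theorem norm_smul_one_sub_gamma_apply_le (r : ℝ) (μ : Fin 4) (α β : Fin 4) (s : ℂ) (hs : ‖s‖ = 1) :
    ‖((r : ℂ) • (1 : Matrix (Fin 4) (Fin 4) ℂ) + s • euclideanGamma μ) α β‖ ≤ |r| + 1 := by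
  rw [Matrix.add_apply, Matrix.smul_apply, Matrix.smul_apply, smul_eq_mul, smul_eq_mul]
  refine (norm_add_le _ _).trans (add_le_add ?_ ?_)
  · rw [norm_mul, Complex.norm_real, Real.norm_eq_abs]
    refine mul_le_of_le_one_right (abs_nonneg r) ?_
    rw [Matrix.one_apply]
    split_ifs <;> simp
  · rw [norm_mul, hs, one_mul]
    exact entry_norm_bound_of_unitary (euclideanGamma_mem_unitaryGroup μ) α β

end Gamma

section Hops

variable {N : ℕ} {G : Type*} [Group G] (ρ : G →* Matrix (Fin N) (Fin N) ℂ)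

/-- Weight of the forward hop `(x,a,α) ← (x+μ̂,b,β)`: `(r·1 − γ_μ)_{αβ} ρ(U(x,μ))_{ab}` on the
fibre `{(x,a,α)}`, zero elsewhere (HJL App. A conventions, as in the torus `wilsonDirac`).
[cite: HernandezJansenLuscher1999, App. A] -/
def fwdHopWeight (U : LGConfig 4 G) (r : ℝ) (μ : Fin 4) (a : Fin N) (α : Fin 4) (b : Fin N)
    (β : Fin 4) (p : ZdSpinorIdx N) : ℂ :=
  if p.2.1 = a ∧ p.2.2 = α then
    ((r : ℂ) • (1 : Matrix (Fin 4) (Fin 4) ℂ) - euclideanGamma μ) α β * ρ (U (p.1, μ)) a b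
  else 0

/-- Weight of the backward hop `(x,a,α) ← (x−μ̂,b,β)`: `(r·1 + γ_μ)_{αβ} (ρ(U(x−μ̂,μ))⁻¹)_{ab}`.
[cite: HernandezJansenLuscher1999, App. A] -/
def bwdHopWeight (U : LGConfig 4 G) (r : ℝ) (μ : Fin 4) (a : Fin N) (α : Fin 4) (b : Fin N)
    (β : Fin 4) (p : ZdSpinorIdx N) : ℂ :=
  if p.2.1 = a ∧ p.2.2 = α then
    ((r : ℂ) • (1 : Matrix (Fin 4) (Fin 4) ℂ) + euclideanGamma μ) α β *
      (ρ (U (p.1 - Pi.single μ 1, μ)))⁻¹ a b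
  else 0

/-- Source index of the forward hop. [folklore] -/
def fwdHopSrc (μ : Fin 4) (b : Fin N) (β : Fin 4) (p : ZdSpinorIdx N) : ZdSpinorIdx N :=
  (p.1 + Pi.single μ 1, b, β)

/-- Source index of the backward hop. [folklore] -/
def bwdHopSrc (μ : Fin 4) (b : Fin N) (β : Fin 4) (p : ZdSpinorIdx N) : ZdSpinorIdx N :=
  (p.1 - Pi.single μ 1, b, β)

/-- The forward source map is injective on the support of the forward weight. [folklore] -/
theorem fwdHopSrc_injOn (U : LGConfig 4 G) (r : ℝ) (μ : Fin 4) (a : Fin N) (α : Fin 4) (b : Fin N)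
    (β : Fin 4) :
    Set.InjOn (fwdHopSrc (N := N) μ b β) {p | fwdHopWeight ρ U r μ a α b β p ≠ 0} := by
  intro p hp q hq h
  simp only [Set.mem_setOf_eq, fwdHopWeight, ne_eq, ite_eq_right_iff, Classical.not_imp] at hp hq
  simp only [fwdHopSrc, Prod.mk.injEq, add_left_inj] at h
  exact Prod.ext h.1 (Prod.ext (hp.1.1.trans hq.1.1.symm) (hp.1.2.trans hq.1.2.symm))

/-- The backward source map is injective on the support of the backward weight. [folklore] -/
theorem bwdHopSrc_injOn (U : LGConfig 4 G) (r : ℝ) (μ : Fin 4) (a : Fin N) (α : Fin 4) (b : Fin N)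
    (β : Fin 4) :
    Set.InjOn (bwdHopSrc (N := N) μ b β) {p | bwdHopWeight ρ U r μ a α b β p ≠ 0} := by
  intro p hp q hq h
  simp only [Set.mem_setOf_eq, bwdHopWeight, ne_eq, ite_eq_right_iff, Classical.not_imp] at hp hq
  simp only [bwdHopSrc, Prod.mk.injEq, sub_left_inj] at h
  exact Prod.ext h.1 (Prod.ext (hp.1.1.trans hq.1.1.symm) (hp.1.2.trans hq.1.2.symm))

variable (hρ : ∀ g, ρ g ∈ Matrix.unitaryGroup (Fin N) ℂ)
include hρ

/-- `|forward weight| ≤ |r| + 1` for a unitary representation. [folklore] -/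
theorem norm_fwdHopWeight_le (U : LGConfig 4 G) (r : ℝ) (μ : Fin 4) (a : Fin N) (α : Fin 4)
    (b : Fin N) (β : Fin 4) (p : ZdSpinorIdx N) : ‖fwdHopWeight ρ U r μ a α b β p‖ ≤ |r| + 1 := by
  unfold fwdHopWeight
  split_ifs
  · rw [norm_mul]
    have h1 := norm_smul_one_sub_gamma_apply_le r μ α β (-1) (by simp)
    rw [neg_one_smul, ← sub_eq_add_neg] at h1
    have h2 : ‖ρ (U (p.1, μ)) a b‖ ≤ 1 := entry_norm_bound_of_unitary (hρ _) a b
    calc _ ≤ (|r| + 1) * 1 := mul_le_mul h1 h2 (norm_nonneg _) (by positivity)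
      _ = |r| + 1 := mul_one _
  · rw [norm_zero]; positivity

/-- `|backward weight| ≤ |r| + 1` for a unitary representation. [folklore] -/
theorem norm_bwdHopWeight_le (U : LGConfig 4 G) (r : ℝ) (μ : Fin 4) (a : Fin N) (α : Fin 4)
    (b : Fin N) (β : Fin 4) (p : ZdSpinorIdx N) : ‖bwdHopWeight ρ U r μ a α b β p‖ ≤ |r| + 1 := by
  unfold bwdHopWeight
  split_ifs
  · rw [norm_mul]
    have h1 := norm_smul_one_sub_gamma_apply_le r μ α β 1 (by simp)
    rw [one_smul] at h1
    have hu : (ρ (U (p.1 - Pi.single μ 1, μ)))⁻¹ ∈ Matrix.unitaryGroup (Fin N) ℂ := by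
      rw [Matrix.inv_eq_left_inv (Matrix.mem_unitaryGroup_iff'.mp (hρ _))]
      exact Unitary.star_mem (hρ _)
    have h2 : ‖(ρ (U (p.1 - Pi.single μ 1, μ)))⁻¹ a b‖ ≤ 1 := entry_norm_bound_of_unitary hu a b
    calc _ ≤ (|r| + 1) * 1 := mul_le_mul h1 h2 (norm_nonneg _) (by positivity)
      _ = |r| + 1 := mul_one _
  · rw [norm_zero]; positivity

/-- **The forward covariant hop** `f ↦ [(x,a,α) ↦ (r·1 − γ_μ)_{αβ} ρ(U(x,μ))_{ab} f(x+μ̂,b,β)]`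
as a bounded operator on `ℓ²`, of norm `≤ |r| + 1`. [cite: HernandezJansenLuscher1999, App. A] -/
def fwdHop (U : LGConfig 4 G) (r : ℝ) (μ : Fin 4) (a : Fin N) (α : Fin 4) (b : Fin N) (β : Fin 4) :
    ZdSpinorSpace N →L[ℂ] ZdSpinorSpace N :=
  crossShift (fwdHopWeight ρ U r μ a α b β) (fwdHopSrc μ b β) (fwdHopSrc_injOn ρ U r μ a α b β)
    (by positivity : (0 : ℝ) ≤ |r| + 1) (norm_fwdHopWeight_le ρ hρ U r μ a α b β)

/-- **The backward covariant hop** `f ↦ [(x,a,α) ↦ (r·1 + γ_μ)_{αβ} (ρ(U(x−μ̂,μ))⁻¹)_{ab} f(x−μ̂,b,β)]`.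
[cite: HernandezJansenLuscher1999, App. A] -/
def bwdHop (U : LGConfig 4 G) (r : ℝ) (μ : Fin 4) (a : Fin N) (α : Fin 4) (b : Fin N) (β : Fin 4) :
    ZdSpinorSpace N →L[ℂ] ZdSpinorSpace N :=
  crossShift (bwdHopWeight ρ U r μ a α b β) (bwdHopSrc μ b β) (bwdHopSrc_injOn ρ U r μ a α b β)
    (by positivity : (0 : ℝ) ≤ |r| + 1) (norm_bwdHopWeight_le ρ hρ U r μ a α b β)

/-- Pointwise action of the forward hop. [folklore] -/
theorem fwdHop_apply (U : LGConfig 4 G) (r : ℝ) (μ : Fin 4) (a : Fin N) (α : Fin 4) (b : Fin N)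
    (β : Fin 4) (f : ZdSpinorSpace N) (p : ZdSpinorIdx N) :
    fwdHop ρ hρ U r μ a α b β f p = fwdHopWeight ρ U r μ a α b β p * f (p.1 + Pi.single μ 1, b, β) :=
  rfl

/-- Pointwise action of the backward hop. [folklore] -/
theorem bwdHop_apply (U : LGConfig 4 G) (r : ℝ) (μ : Fin 4) (a : Fin N) (α : Fin 4) (b : Fin N)
    (β : Fin 4) (f : ZdSpinorSpace N) (p : ZdSpinorIdx N) :
    bwdHop ρ hρ U r μ a α b β f p = bwdHopWeight ρ U r μ a α b β p * f (p.1 - Pi.single μ 1, b, β) :=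
  rfl

/-- Norm bound of the hops. [folklore] -/
theorem norm_fwdHop_le (U : LGConfig 4 G) (r : ℝ) (μ : Fin 4) (a : Fin N) (α : Fin 4) (b : Fin N)
    (β : Fin 4) : ‖fwdHop ρ hρ U r μ a α b β‖ ≤ |r| + 1 :=
  norm_crossShift_le _ _ _ _ _

/-- Norm bound of the hops. [folklore] -/
theorem norm_bwdHop_le (U : LGConfig 4 G) (r : ℝ) (μ : Fin 4) (a : Fin N) (α : Fin 4) (b : Fin N)
    (β : Fin 4) : ‖bwdHop ρ hρ U r μ a α b β‖ ≤ |r| + 1 :=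
  norm_crossShift_le _ _ _ _ _

/-! ### The Wilson–Dirac operator on `ℤ⁴` -/

/-- **The Wilson–Dirac operator on the infinite lattice** as a bounded operator on
`ℓ²(ℤ⁴ × Fin N × Fin 4)`:
`D_W = (m + 4r)·1 − ½ Σ_μ [(r − γ_μ) U(x,μ) T_μ + (r + γ_μ) U(x−μ̂,μ)⁻¹ T_μ⁻¹]`, written as the
finite sum of its elementary covariant hops — the same kernel as the torus `wilsonDirac ρ U m r`
with `TorusSite 4 L` replaced by `ℤ⁴` (`wilsonDiracOpZd_apply`), i.e. the kernel of the tree's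
infinite-matrix `wilsonDiracZd ρ euclideanGamma U m r` (`BlockFermionRG.lean`) at one flavour; the
operator (rather than kernel) form is what the functional calculus below needs.
[cite: HernandezJansenLuscher1999, App. A] -/
def wilsonDiracOpZd (U : LGConfig 4 G) (m r : ℝ) : ZdSpinorSpace N →L[ℂ] ZdSpinorSpace N :=
  ((m + 4 * r : ℝ) : ℂ) • ContinuousLinearMap.id ℂ (ZdSpinorSpace N) -
    (1 / 2 : ℂ) • ∑ μ : Fin 4, ∑ a : Fin N, ∑ α : Fin 4, ∑ b : Fin N, ∑ β : Fin 4,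
      (fwdHop ρ hρ U r μ a α b β + bwdHop ρ hρ U r μ a α b β)

omit hρ in
/-- Coercion of a finite sum of bounded operators applied to a vector, evaluated at an index.
[folklore] -/
theorem clm_sum_apply_apply {ι : Type*} (s : Finset ι)
    (T : ι → ZdSpinorSpace N →L[ℂ] ZdSpinorSpace N) (f : ZdSpinorSpace N) (p : ZdSpinorIdx N) :
    ((∑ i ∈ s, T i) f) p = ∑ i ∈ s, (T i f) p := by
  rw [_root_.sum_apply, lp.coeFn_sum, Finset.sum_apply]

/-- **Pointwise formula for `D_W` on `ℤ⁴`** — the kernel of the torus `wilsonDirac` (and of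
`wilsonDiracZd … euclideanGamma …` at one flavour) with `TorusSite` replaced by `ℤ⁴`:
`(D_W f)(x,a,α) = (m+4r) f(x,a,α) − ½ Σ_μ Σ_{b,β} [(r−γ_μ)_{αβ} ρ(U(x,μ))_{ab} f(x+μ̂,b,β)
  + (r+γ_μ)_{αβ} (ρ(U(x−μ̂,μ))⁻¹)_{ab} f(x−μ̂,b,β)]`. [cite: HernandezJansenLuscher1999, App. A] -/
theorem wilsonDiracOpZd_apply (U : LGConfig 4 G) (m r : ℝ) (f : ZdSpinorSpace N) (p : ZdSpinorIdx N) :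
    wilsonDiracOpZd ρ hρ U m r f p =
      ((m + 4 * r : ℝ) : ℂ) * f p -
        (1 / 2 : ℂ) * ∑ μ : Fin 4, ∑ b : Fin N, ∑ β : Fin 4,
          (((r : ℂ) • (1 : Matrix (Fin 4) (Fin 4) ℂ) - euclideanGamma μ) p.2.2 β *
              ρ (U (p.1, μ)) p.2.1 b * f (p.1 + Pi.single μ 1, b, β) +
            ((r : ℂ) • (1 : Matrix (Fin 4) (Fin 4) ℂ) + euclideanGamma μ) p.2.2 β *
              (ρ (U (p.1 - Pi.single μ 1, μ)))⁻¹ p.2.1 b * f (p.1 - Pi.single μ 1, b, β)) := by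
  simp only [wilsonDiracOpZd, _root_.sub_apply, _root_.smul_apply,
    ContinuousLinearMap.id_apply, lp.coeFn_sub, lp.coeFn_smul, Pi.sub_apply, Pi.smul_apply,
    smul_eq_mul, clm_sum_apply_apply, _root_.add_apply, lp.coeFn_add, Pi.add_apply,
    fwdHop_apply, bwdHop_apply, fwdHopWeight, bwdHopWeight]
  congr 1
  congr 1
  refine Finset.sum_congr rfl fun μ _ => ?_
  -- collapse the `(a, α)` sums onto the fibre of `p`
  rw [Finset.sum_eq_single p.2.1 (fun a _ ha => by simp [Ne.symm ha]) (fun h => absurd (mem_univ _) h)]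
  rw [Finset.sum_eq_single p.2.2 (fun α _ hα => by simp [Ne.symm hα]) (fun h => absurd (mem_univ _) h)]
  simp only [and_self, ite_true]

/-! ### `Γ₅`, the Hermitian kernel, the sign function and the overlap operator on `ℤ⁴` -/

omit hρ in
/-- The chirality weight `γ₅ = diag(1,1,−1,−1)` on the spin index. [folklore] -/
theorem norm_gammaFiveWeight_le (p : ZdSpinorIdx N) : ‖(![1, 1, -1, -1] : Fin 4 → ℂ) p.2.2‖ ≤ 1 := by
  obtain ⟨x, a, s⟩ := p
  fin_cases s <;> simp

/-- **`Γ₅` on `ℓ²(ℤ⁴ × Fin N × Fin 4)`**: multiplication by `γ₅ = diag(1,1,−1,−1)` in the spin index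
(chiral basis, as the torus `spinorLift gammaFive`). [folklore] -/
def gammaFiveOpZd : ZdSpinorSpace N →L[ℂ] ZdSpinorSpace N :=
  crossShift (fun p : ZdSpinorIdx N => (![1, 1, -1, -1] : Fin 4 → ℂ) p.2.2) id
    (Set.injOn_id _) zero_le_one norm_gammaFiveWeight_le

omit hρ in
/-- Pointwise action of `Γ₅`. [folklore] -/
theorem gammaFiveOpZd_apply (f : ZdSpinorSpace N) (p : ZdSpinorIdx N) :
    gammaFiveOpZd (N := N) f p = (![1, 1, -1, -1] : Fin 4 → ℂ) p.2.2 * f p :=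
  rfl

/-- **The Hermitian Wilson kernel on `ℤ⁴`**: `H(m₀) = Γ₅ · D_W(U, −m₀, 1)` (the conventions of the
torus `overlapKernel`). [cite: Neuberger1998, eqs. (2) and (11); IgarashiOkuyamaSuzuki2002, §2] -/
def overlapKernelOpZd (U : LGConfig 4 G) (m₀ : ℝ) : ZdSpinorSpace N →L[ℂ] ZdSpinorSpace N :=
  gammaFiveOpZd ∘L wilsonDiracOpZd ρ hρ U (-m₀) 1

/-- **`ε = sign(H)` on `ℤ⁴`**, in Mathlib's continuous functional calculus of the C⋆-algebra of
bounded operators on `ℓ²`: `cfc` over `ℂ` of `z ↦ sign(Re z)` (normal elements), which for a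
self-adjoint `H` is `cfc Real.sign H` (`cfc_real_eq_complex`) — the same function as the torus
`overlapUnitary`'s `cfc Real.sign`. JUNK VALUES: by Mathlib's conventions `cfc f a = 0` unless `a`
is normal AND `f` is continuous on `spectrum ℂ a` (`cfc_apply_of_not_continuousOn`); since
`z ↦ sign(Re z)` is discontinuous at `Re z = 0`, this operator is the intended `H/√H²` exactly when
`H` is self-adjoint with `0 ∉ spectrum H` (the gapped case — e.g. admissible fields in the HJL /
Neuberger range), and is `0` for a gapless `H` (then `overlapDiracZeroOpZd = 1` and
`anomalyDensityZd = 0`). On the torus the spectrum is finite and this issue does not arise.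
[cite: Neuberger1998, eq. (9); IgarashiOkuyamaSuzuki2002, §2] -/
def overlapSignOpZd (U : LGConfig 4 G) (m₀ : ℝ) : ZdSpinorSpace N →L[ℂ] ZdSpinorSpace N :=
  cfc (fun z : ℂ => ((Real.sign z.re : ℝ) : ℂ)) (overlapKernelOpZd ρ hρ U m₀)

/-- **Neuberger's unitary on `ℤ⁴`**: `V = Γ₅ sign(H(m₀))`. [cite: Neuberger1998, eq. (9)] -/
def overlapUnitaryOpZd (U : LGConfig 4 G) (m₀ : ℝ) : ZdSpinorSpace N →L[ℂ] ZdSpinorSpace N :=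
  gammaFiveOpZd ∘L overlapSignOpZd ρ hρ U m₀

/-- **The massless overlap Dirac operator on `ℤ⁴`**: `D₀ = D^∞ = 1 + Γ₅ sign(H(m₀))` (the `μ = 0`
member of the torus `overlapDirac`; IOS's `D^∞`, §2, text after (2.5)). [cite: Neuberger1998, eq. (8); IgarashiOkuyamaSuzuki2002, §2 (text after (2.5), eq. (2.6))] -/
def overlapDiracZeroOpZd (U : LGConfig 4 G) (m₀ : ℝ) : ZdSpinorSpace N →L[ℂ] ZdSpinorSpace N :=
  ContinuousLinearMap.id ℂ (ZdSpinorSpace N) + overlapUnitaryOpZd ρ hρ U m₀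

/-! ### Position-space kernels and the anomaly density -/

omit hρ in
/-- **Position-space kernel** of a bounded operator on `ℓ²(ℤ⁴ × Fin N × Fin 4)`:
`T(p, q) = ⟪δ_p, T δ_q⟫`. [cite: IgarashiOkuyamaSuzuki2002, §2 ("D(x,y)")] -/
def kernelEntryZd (T : ZdSpinorSpace N →L[ℂ] ZdSpinorSpace N) (p q : ZdSpinorIdx N) : ℂ :=
  ⟪lp.single 2 p (1 : ℂ), T (lp.single 2 q (1 : ℂ))⟫_ℂ

omit hρ in
/-- The kernel entry is the `p`-th component of `T δ_q`. [folklore] -/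
theorem kernelEntryZd_eq_apply (T : ZdSpinorSpace N →L[ℂ] ZdSpinorSpace N) (p q : ZdSpinorIdx N) :
    kernelEntryZd T p q = T (lp.single 2 q (1 : ℂ)) p := by
  classical
  rw [kernelEntryZd, lp.inner_single_left]
  simp

/-- **The axial anomaly density on the infinite lattice**:
`𝒜^∞(x) = Σ_{a,α} Re [Γ₅ (1 − ½ D^∞)]((x,a,α),(x,a,α))` — IOS (2.8) (the infinite-lattice version
of (2.1)) / Lüscher's `q(x) = −½ tr{γ₅ D(x,x)}` (1.2) (the two agree since `tr γ₅ = 0`), for the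
overlap operator on `ℤ⁴` with projection point `m₀`.
[cite: IgarashiOkuyamaSuzuki2002, §2 eqs. (2.8), (2.1); Luscher1999AbelianTopology, eq. (1.2)] -/
def anomalyDensityZd (U : LGConfig 4 G) (m₀ : ℝ) (x : Site 4) : ℝ :=
  ∑ a : Fin N, ∑ α : Fin 4,
    (kernelEntryZd (gammaFiveOpZd ∘L (ContinuousLinearMap.id ℂ (ZdSpinorSpace N) -
        (1 / 2 : ℂ) • overlapDiracZeroOpZd ρ hρ U m₀)) (x, a, α) (x, a, α)).re

end Hops

end Literature.MathematicalPhysics.QuantumLattice
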